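import Summits.QuantumFields.YangMills.Theses.ScalingWindowSplit
import Summits.QuantumFields.YangMills.Theorems.ScalingWindowSplitExistenceLegFromLattice
import Summits.QuantumFields.YangMills.Theorems.SelfNormalisedSkewness.Negative.TreeLevelSkewnessVanishes

/-!
# Skeleton — crux `stmt-QuantumFields-18170` (`ScalingWindowSplit.SelfNormalisedSkewnessGapped`, W₂ᴳ),
# line `quartic-uv-transfer`: the skewness floor paid in CANONICAL UNITS at ONE SHORT SCALE

Crux-strategist `cstrat-stmt-QuantumFields-18170-b1` (gen 1, 2026-08-17).  Card: `Lines/quartic-uv-transfer.md`.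

THE LEVER.  The crux's conclusion is dimensionless (self-normalised by `c'_k = 1/√T⁰_k(u,θu)`), and the
affine renormalisation seam of the route gives, at ORDER THREE, the exact identity
`κ₃^canon_k(f,g,h) = T⁰_k(u,θu)^{-3/2} · κ₃⁰_k(f,g,h)` (`thirdCumulantSeam`, PROVED below from
`smearedLatticeField_affine` — it is verbatim the birth line's registered `stub_thirdCumulantSeam`, which it
discharges; the order-2 twin is the landed `trunc_rescale`).  So the floor splits into
three statements about the BARE Wilson plaquette field in canonical units `a_k⁴`:
* `stub_pairCeiling` (2-point, UPPER, at the reference scale; = the birth line's `stub_canonicalCeiling`, shared): `T⁰_k(u,θu) ≤ C a_k⁸` — canonical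
  dimension 4 of `tr F²` from above; ⇐ window (it moves the pair to `τ₋₁u`, physical separation ≥ 2) +
  the hub's β-uniform power-law first rung `|⟨P₀;P_x⟩| ≤ C|x|⁻⁸` (crux idea `af-power-law-first-rung` on
  stmt-15828, `PlaquettePowerLawBound`) + Schwartz summation; RP monotonicity optional.
* `stub_shortPairFloor` (2-point, LOWER, at SHORT scale): every non-zero past-supported bump `w` in a
  small ball has `T⁰_k(w,θw) ≥ c a_k⁸` — no ultraviolet DRIFT: a coupling at fixed physical scale tending
  to `0` along a subsequence would, by asymptotically free running over the then diverging range of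
  near-Gaussian scales, produce power-law plaquette correlations contradicting the volume-uniform gap
  `HasLatticeMassGap` (the GAP is consumed here; sibling socket: `stub_twoPointPositivity` / proved
  `stub_twoPointOfKL` of `Cruxes/ContinuumLegGivenGap/Lines/duality_selection_nlo_skewness.lean`).
* `stub_quarticSkewTransfer` (3-point vs (2-point)², at SHORT scale, scale-free — the HARDEST): for every
  radius `ρ₀` some triple `(w, h, θw)` inside has `|κ₃⁰_k(w,h,θw)| ≥ s · a_k⁻⁴ · T⁰_k(w,θw)²`.  The tree-level
  term of `κ₃⁰` vanishes identically for the six-plane action density (landed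
  `Negative.treeLevelSkewness_vanishes`, the reason W₂ died at `U(1)`), so both sides are `O(ḡ⁸(ε))` and
  the ratio `s` is the scheme-free, log-free ONE-LOOP skewness shape divided by the squared two-point tree
  shape — the quartic skewness law `κ₃ ≈ s κ₂²` REGISTERED on the sibling crux 15828 as
  `stub_quarticSkewnessLaw` (K1 = NLO accuracy of a volume-uniform UV engine on composite insertions at
  one short scale; K2 = `s ≠ 0`, desk-settled in `Lines/duality-selection-K2.md`: free OPE `F²×F² ∋ T_ab`
  with coefficient `−32/π²` and `⟨T_ab F²⟩ ∝ b₀ dim G` by the trace anomaly; in the `F²` channel the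
  one-loop separated-point coefficient is RG-FORCED `∝ b₀ × (tree contact coefficient)`, the latter being
  the kernel-checked `tr K(h) = −3 tr h`).  The WINDOW is what makes "short" uniformly perturbative in `k`
  (`ξ_k ≥ 2/log M`), the hierarchy `supp h` hugging `supp w` is the prover's to choose (∃ w h).
Composition `SelfNormalisedSkewnessGapped_of` (sorry-free): `δ := s c²/√C³`; `SelfNormalisedSkewnessGapped_skeleton` plugs the three stubs BY NAME.

Every stub is ULTRAVIOLET-ENGINE grade (Bałaban + gauge-invariant observables, child-2 class of the 15828
split), none is the summit: the infrared (gap, one scale, non-triviality of the reference pair) is entirely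
SUPPLIED by the crux's hypotheses and consumed where named.  None restates the crux: the two 2-point stubs
are an upper and a lower bound in units `a⁸` (the crux is unit-free), the 3-point stub is relative to
`T(w)²`, not to `T(u)^{3/2}`, and only the three together give the crux.

Disproof honoured (no `Disproof.lean` for 18170 exists yet; inputs: `ATTACK-birth.md` of 18170, the 18944
`Disproof.lean` F1–F6): F1/p161959 `selfNormalisedSkewnessGapped_false_without_floor` — the floor is USED
(composition: `T⁰_k(u) > 0`, and it is what makes `C > 0`); the rev-8 gap — USED by `stub_shortPairFloor`;
F2 `treeLevelSkewness_vanishes` — the reason the transfer is QUARTIC (`κ₂²`), not `κ₂^{3/2}`; F6(a) (lattice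
reflection offset of the site-based density) — no stub asserts exact RP of `T⁰`; F6(c) (a `κ₄` floor has
tree support but does not feed `IsNonGaussian`) — not used.  `TreeLevelSkewnessVanishes` is imported so the scratch
check sees it (the p161959 file is cited by name; it was not yet built on the farm at registration time).
-/

noncomputable section

open scoped SchwartzMap BigOperators Topology
open Filter Set MeasureTheory ProbabilityTheory
open Literature.MathematicalPhysics.QuantumLattice Literature.MathematicalPhysics.AQFT
  Literature.MathematicalPhysics.QuantumFieldTheory

namespace Summit.QuantumFields.YangMills.Cruxes.SelfNormalisedSkewnessGapped.QuarticUvTransfer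

/-- Euclidean `ℝ⁴`. [folklore] -/
abbrev E4 : Type := EuclideanSpace ℝ (Fin 4)

section Vocabulary

variable {G : Type} [Group G] [TopologicalSpace G] [IsTopologicalGroup G] [CompactSpace G]
  [MeasurableSpace G] [BorelSpace G]

/-- The crux's BARE scheme (`c ≡ 1`, `m ≡ 0`; spacings, couplings, tori unchanged). [folklore] -/
def bare (sch : SpeciesScheme (YMSpecies G)) : SpeciesScheme (YMSpecies G) :=
  { sch with c := fun _ _ => 1, m := fun _ _ => 0 }

/-- The crux's `T w k`: BARE truncated plaquette two-point function at the reflected pair `(w, θw)`.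
[folklore] -/
def Tbare (r : LatticeRep G) (sch : SpeciesScheme (YMSpecies G)) (w : 𝓢(E4, ℝ)) (k : ℕ) : ℝ :=
  latticeSchwinger r.ρ (bare sch) (fun s => s.F) k (1 + 1) (fun _ => r.curvature) ![w, thetaTest 4 w] -
    latticeSchwinger r.ρ (bare sch) (fun s => s.F) k 1 (fun _ => r.curvature) ![w] *
      latticeSchwinger r.ρ (bare sch) (fun s => s.F) k 1 (fun _ => r.curvature) ![thetaTest 4 w]

/-- The crux's SELF-NORMALISED scheme `canon` (`c'_k = 1/√T_k(u)`, `m'_k = ⟨F⟩_k`). [folklore] -/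
def canon (r : LatticeRep G) (sch : SpeciesScheme (YMSpecies G)) (u : 𝓢(E4, ℝ)) :
    SpeciesScheme (YMSpecies G) :=
  { sch with c := fun _ k => (Real.sqrt (Tbare r sch u k))⁻¹,
             m := fun _ k => ∫ U, r.curvature.F (torusLift (sch.side k) U) ∂(wilsonMeasure r.ρ (sch.β k)) }

/-- The joint third cumulant `κ₃(f, g, h)` of the smeared curvature field of an ARBITRARY scheme `S` at
step `k` (the crux's cumulant polynomial `S₃ − ΣS₁S₂ + 2S₁S₁S₁`). [folklore] -/
def kappa3 (r : LatticeRep G) (S : SpeciesScheme (YMSpecies G)) (f g h : 𝓢(E4, ℝ)) (k : ℕ) : ℝ :=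
  latticeSchwinger r.ρ S (fun s => s.F) k 3 (fun _ => r.curvature) ![f, g, h] -
    latticeSchwinger r.ρ S (fun s => s.F) k 1 (fun _ => r.curvature) ![f] *
      latticeSchwinger r.ρ S (fun s => s.F) k 2 (fun _ => r.curvature) ![g, h] -
    latticeSchwinger r.ρ S (fun s => s.F) k 1 (fun _ => r.curvature) ![g] *
      latticeSchwinger r.ρ S (fun s => s.F) k 2 (fun _ => r.curvature) ![f, h] -
    latticeSchwinger r.ρ S (fun s => s.F) k 1 (fun _ => r.curvature) ![h] *
      latticeSchwinger r.ρ S (fun s => s.F) k 2 (fun _ => r.curvature) ![f, g] +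
    2 * (latticeSchwinger r.ρ S (fun s => s.F) k 1 (fun _ => r.curvature) ![f] *
      latticeSchwinger r.ρ S (fun s => s.F) k 1 (fun _ => r.curvature) ![g] *
      latticeSchwinger r.ρ S (fun s => s.F) k 1 (fun _ => r.curvature) ![h])

/-- The crux's hypothesis block at the datum `(r, sch, u, p, M, Δ)`: weak coupling, `0 < Δ`, the
volume-uniform lattice gap, polynomial volumes, past support of `u`, eventually floor ∧ window at `u`
(the six hypotheses of W₂ᴳ in order, conjoined; verbatim the birth line's `CruxHyps`). [folklore] -/
def CruxHyps (r : LatticeRep G) (sch : SpeciesScheme (YMSpecies G)) (u : 𝓢(E4, ℝ)) (p : ℕ)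
    (M Δ : ℝ) : Prop :=
  sch.HasWeakCouplingLimit ∧ 0 < Δ ∧ HasLatticeMassGap r sch Δ ∧
    (∃ N : ℕ, 1 ≤ N ∧ ∀ᶠ k in Filter.atTop, (sch.a k)⁻¹ ≤ (sch.a k * (sch.L k : ℝ)) ^ N) ∧
      tsupport u ⊆ {y : E4 | y 0 < 0} ∧
        ∀ᶠ k in Filter.atTop, (sch.a k) ^ p ≤ Tbare r sch u k ∧
          Tbare r sch u k ≤ M * Tbare r sch (timeShiftTest 4 (-1) u) k

end Vocabulary

/-! ## § The three stub STATEMENTS — `def Sig.stub_<name> : Prop` (last name component = the stub's name,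
so that the skeleton audit admits them as hypotheses of `_of`; each is pinned to the type of `theorem stub_<name>`
by an `example` below) -/

/-- **Statement of stub 1 — canonical-dimension CEILING of the reference pair** (two-point, UPPER, UV-stability
grade; the SAME statement as the birth line's `CanonicalCeiling` / `stub_canonicalCeiling`, in definitionally equal
vocabulary — one proof serves both lines): under the crux hypotheses `∃ C, ∀ᶠ k, T⁰_k(u,θu) ≤ C · a_k⁸`. -/
def Sig.stub_pairCeiling : Prop :=
  ∀ (G : Type) [Group G] [TopologicalSpace G] [IsTopologicalGroup G] [CompactSpace G]
      [MeasurableSpace G] [BorelSpace G] (r : LatticeRep G) (sch : SpeciesScheme (YMSpecies G))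
      (u : 𝓢(E4, ℝ)) (p : ℕ) (M Δ : ℝ), CruxHyps r sch u p M Δ →
      ∃ C : ℝ, ∀ᶠ k in Filter.atTop, Tbare r sch u k ≤ C * (sch.a k) ^ 8

/-- **Statement of stub 2 — short-pair FLOOR** (two-point, LOWER, at short scale; no ultraviolet drift): under
the crux hypotheses there is `ρ₀ > 0` such that every non-zero past-supported `w` supported in the closed ball
`B(0, ρ₀)` has `∃ c > 0, ∀ᶠ k, c · a_k⁸ ≤ T⁰_k(w,θw)`. -/
def Sig.stub_shortPairFloor : Prop :=
  ∀ (G : Type) [Group G] [TopologicalSpace G] [IsTopologicalGroup G] [CompactSpace G]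
      [MeasurableSpace G] [BorelSpace G] (r : LatticeRep G) (sch : SpeciesScheme (YMSpecies G))
      (u : 𝓢(E4, ℝ)) (p : ℕ) (M Δ : ℝ), CruxHyps r sch u p M Δ →
      ∃ ρ₀ : ℝ, 0 < ρ₀ ∧ ∀ w : 𝓢(E4, ℝ), w ≠ 0 → tsupport w ⊆ {y : E4 | y 0 < 0} →
        tsupport w ⊆ Metric.closedBall (0 : E4) ρ₀ →
          ∃ c : ℝ, 0 < c ∧ ∀ᶠ k in Filter.atTop, c * (sch.a k) ^ 8 ≤ Tbare r sch w k

/-- **Statement of stub 3 — QUARTIC SKEW TRANSFER at one short scale** (three-point vs squared two-point,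
scale-free; the HARDEST): under the crux hypotheses, for every `ρ₀ > 0` there are a non-zero past-supported `w`
in `B(0, ρ₀)`, an `h` with `supp h` disjoint from `supp w` and `supp θw`, and `s > 0` with eventually
`s · a_k⁻⁴ · T⁰_k(w,θw)² ≤ |κ₃⁰_k(w, h, θw)|`. -/
def Sig.stub_quarticSkewTransfer : Prop :=
  ∀ (G : Type) [Group G] [TopologicalSpace G] [IsTopologicalGroup G] [CompactSpace G]
      [MeasurableSpace G] [BorelSpace G] (r : LatticeRep G) (sch : SpeciesScheme (YMSpecies G))
      (u : 𝓢(E4, ℝ)) (p : ℕ) (M Δ : ℝ), CruxHyps r sch u p M Δ →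
      ∀ ρ₀ : ℝ, 0 < ρ₀ → ∃ (w h : 𝓢(E4, ℝ)), w ≠ 0 ∧ tsupport w ⊆ {y : E4 | y 0 < 0} ∧
        tsupport w ⊆ Metric.closedBall (0 : E4) ρ₀ ∧ Disjoint (tsupport w) (tsupport h) ∧
        Disjoint (tsupport h) (tsupport (thetaTest 4 w)) ∧
        ∃ s : ℝ, 0 < s ∧ ∀ᶠ k in Filter.atTop,
          s * ((sch.a k) ^ 4)⁻¹ * (Tbare r sch w k) ^ 2 ≤ |kappa3 r (bare sch) w h (thetaTest 4 w) k|

/-! ## § The three registered stubs (the ONLY `sorry`s of the file; statements restated in full) -/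

/-- **Stub 1 — `stub_pairCeiling` (two-point UPPER bound at the reference scale; UV-stability grade; size L).**
At every admissible datum of the crux, the bare truncated plaquette two-point function at the reference
pair is `O(a_k⁸)`: `T⁰_k(u,θu) ≤ C a_k⁸` eventually.  Intended proof: the window moves the claim to the pair
`(τ₋₁u, θτ₋₁u)` at physical separation `≥ 2`; there `T⁰_k(τ₋₁u) = a_k⁸ Σ_{x,y} u(a_kx) u(a_kθy) C_k(x,y)` and
the β-uniform canonical power law `|C_k(x,y)| ≤ C'/|x−y|⁸` (the hub's first rung `PlaquettePowerLawBound`,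
crux idea `af-power-law-first-rung` on stmt-15828, all directions, volume-uniform — perturbatively
`c_r g⁴/|x−y|⁸`, frozen through the crossover, exponential beyond `ξ`) gives `≤ C' 2⁻⁸ ‖u‖₁² a_k⁸`.
Canonical dimension FOUR of `tr F²` from above; no limit, no uniqueness.  SHARED with the birth line
(`stub_canonicalCeiling`, same statement). [folklore] -/
theorem stub_pairCeiling :
    ∀ (G : Type) [Group G] [TopologicalSpace G] [IsTopologicalGroup G] [CompactSpace G]
      [MeasurableSpace G] [BorelSpace G] (r : LatticeRep G) (sch : SpeciesScheme (YMSpecies G))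
      (u : 𝓢(E4, ℝ)) (p : ℕ) (M Δ : ℝ), CruxHyps r sch u p M Δ →
      ∃ C : ℝ, ∀ᶠ k in Filter.atTop, Tbare r sch u k ≤ C * (sch.a k) ^ 8 := by
  sorry

/-- **Stub 2 — `stub_shortPairFloor` (two-point LOWER bound at short scale; no ultraviolet drift; size L/XL).**  At
every admissible datum there is a radius `ρ₀ > 0` such that EVERY non-zero bump `w` supported in the past
half-space and in the closed ball `B(0, ρ₀)` has `T⁰_k(w,θw) ≥ c(w) a_k⁸` eventually.  Intended proof: on
such pairs RG-improved perturbation theory is asymptotic (the window pins `ξ_k ≥ 2/log M`, so scales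
`≪ 1/log M` are uniformly ultraviolet), `T⁰_k(w) = a_k⁸ ḡ_k(ρ₀)⁴ Q(w)(1 + o(1))` with `Q(w) > 0` the free
dimension-4 reflection form (`trace_K_h₀_sq_ne_zero`); a subsequence with `ḡ_k(ρ₀) → 0` runs, by
asymptotic freedom, into a diverging range of near-Gaussian scales with power-law plaquette correlations,
contradicting the volume-uniform exponential clustering `HasLatticeMassGap r sch Δ` (physical `ξ_k ≤ 1/Δ`).
This is where the GAP is consumed.  Sibling socket: `stub_twoPointPositivity` / proved `stub_twoPointOfKL` of
`Cruxes/ContinuumLegGivenGap/Lines/duality_selection_nlo_skewness.lean` (two-point floor from Källén–Lehmann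
positivity of every subsequential limit + compactness). [folklore] -/
theorem stub_shortPairFloor :
    ∀ (G : Type) [Group G] [TopologicalSpace G] [IsTopologicalGroup G] [CompactSpace G]
      [MeasurableSpace G] [BorelSpace G] (r : LatticeRep G) (sch : SpeciesScheme (YMSpecies G))
      (u : 𝓢(E4, ℝ)) (p : ℕ) (M Δ : ℝ), CruxHyps r sch u p M Δ →
      ∃ ρ₀ : ℝ, 0 < ρ₀ ∧ ∀ w : 𝓢(E4, ℝ), w ≠ 0 → tsupport w ⊆ {y : E4 | y 0 < 0} →
        tsupport w ⊆ Metric.closedBall (0 : E4) ρ₀ →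
          ∃ c : ℝ, 0 < c ∧ ∀ᶠ k in Filter.atTop, c * (sch.a k) ^ 8 ≤ Tbare r sch w k := by
  sorry

/-- **Stub 3 — `stub_quarticSkewTransfer` (the quartic skew law at one short scale; size XL; the HARDEST).**
At every admissible datum and for every radius `ρ₀ > 0` there are a non-zero past-supported bump `w` inside
`B(0, ρ₀)` and a test function `h` with `supp h` disjoint from `supp w` and from `supp θw`, and `s > 0`, such
that eventually `s · a_k⁻⁴ · T⁰_k(w,θw)² ≤ |κ₃⁰_k(w, h, θw)|`.  Intended proof (geometry the prover's: `h`
HUGGING `w` at distance `ε' ≪ dist(w, θw)`): NLO-sharp asymptotic perturbation theory for the bare 2- and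
3-point plaquette functions at this one short scale, uniformly in `k` (K1 of the sibling
`stub_quarticSkewnessLaw`, crux 15828); the tree term of `κ₃⁰` is `0` (`treeLevelSkewness_vanishes`), so
`κ₃⁰ = a¹² ḡ⁸ S₁(w,h) (1+o(1))` against `T⁰(w)² = a¹⁶ ḡ⁸ Q(w)² (1+o(1))`, and `S₁ ≠ 0` is forced in the
hugging limit by the OPE: `F² × F² ∋ T_ab` (tree, `−32/π²`) with `⟨T_ab F²⟩ ∝ b₀ dim G` (trace anomaly;
desk-settled `Cruxes/ContinuumLegGivenGap/Lines/duality-selection-K2.md`), and in the `F²` channel a one-loop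
separated-point coefficient `∝ b₀ ×` (tree contact coefficient `tr K(h) = −3 tr h`, kernel-checked), both
RG-forced and vanishing iff `b₀ = 0` (abelian — where the gap fails anyway).  Scale-free (weight 12 = 12 under
`a ↦ λa`), bare-normalised (no `c ↦ λc` twin). [folklore] -/
theorem stub_quarticSkewTransfer :
    ∀ (G : Type) [Group G] [TopologicalSpace G] [IsTopologicalGroup G] [CompactSpace G]
      [MeasurableSpace G] [BorelSpace G] (r : LatticeRep G) (sch : SpeciesScheme (YMSpecies G))
      (u : 𝓢(E4, ℝ)) (p : ℕ) (M Δ : ℝ), CruxHyps r sch u p M Δ →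
      ∀ ρ₀ : ℝ, 0 < ρ₀ → ∃ (w h : 𝓢(E4, ℝ)), w ≠ 0 ∧ tsupport w ⊆ {y : E4 | y 0 < 0} ∧
        tsupport w ⊆ Metric.closedBall (0 : E4) ρ₀ ∧ Disjoint (tsupport w) (tsupport h) ∧
        Disjoint (tsupport h) (tsupport (thetaTest 4 w)) ∧
        ∃ s : ℝ, 0 < s ∧ ∀ᶠ k in Filter.atTop,
          s * ((sch.a k) ^ 4)⁻¹ * (Tbare r sch w k) ^ 2 ≤ |kappa3 r (bare sch) w h (thetaTest 4 w) k| := by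
  sorry

/-! Pins: each `Sig.stub_<name>` IS the type of `stub_<name>` (definitional unfolding only). -/

example : Sig.stub_pairCeiling := stub_pairCeiling
example : Sig.stub_shortPairFloor := stub_shortPairFloor
example : Sig.stub_quarticSkewTransfer := stub_quarticSkewTransfer

/-! ## The order-3 renormalisation seam (PROVED): `κ₃^S = c_k³ · κ₃⁰` for every scheme `S` -/

section Seam

/-- **Third joint cumulant = third central mixed moment**, for bounded measurable variables on a
probability space. [folklore] -/
theorem cumulant3_eq_central {Ω : Type*} [MeasurableSpace Ω] {μ : Measure Ω} [IsProbabilityMeasure μ]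
    {A B C : Ω → ℝ} (hA : Measurable A) (hB : Measurable B) (hC : Measurable C)
    (bA : ∃ K, ∀ ω, |A ω| ≤ K) (bB : ∃ K, ∀ ω, |B ω| ≤ K) (bC : ∃ K, ∀ ω, |C ω| ≤ K) :
    (∫ ω, A ω * B ω * C ω ∂μ) - (∫ ω, A ω ∂μ) * (∫ ω, B ω * C ω ∂μ) -
        (∫ ω, B ω ∂μ) * (∫ ω, A ω * C ω ∂μ) - (∫ ω, C ω ∂μ) * (∫ ω, A ω * B ω ∂μ) +
        2 * ((∫ ω, A ω ∂μ) * (∫ ω, B ω ∂μ) * (∫ ω, C ω ∂μ)) =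
      ∫ ω, (A ω - ∫ ω', A ω' ∂μ) * (B ω - ∫ ω', B ω' ∂μ) * (C ω - ∫ ω', C ω' ∂μ) ∂μ := by
  -- integrability of every monomial (bounded measurable on a probability space)
  have hint : ∀ {F : Ω → ℝ}, Measurable F → (∃ K, ∀ ω, |F ω| ≤ K) → Integrable F μ := by
    intro F hF hb
    obtain ⟨K, hK⟩ := hb
    exact Integrable.of_bound hF.aestronglyMeasurable K
      (ae_of_all _ fun ω => by rw [Real.norm_eq_abs]; exact hK ω)
  have hbmul : ∀ {F F' : Ω → ℝ}, (∃ K, ∀ ω, |F ω| ≤ K) → (∃ K, ∀ ω, |F' ω| ≤ K) →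
      ∃ K, ∀ ω, |F ω * F' ω| ≤ K := by
    intro F F' hb hb'
    obtain ⟨K, hK⟩ := hb
    obtain ⟨K', hK'⟩ := hb'
    refine ⟨K * K', fun ω => ?_⟩
    rw [abs_mul]
    exact mul_le_mul (hK ω) (hK' ω) (abs_nonneg _) ((abs_nonneg _).trans (hK ω))
  have iA : Integrable A μ := hint hA bA
  have iB : Integrable B μ := hint hB bB
  have iC : Integrable C μ := hint hC bC
  have iAB : Integrable (fun ω => A ω * B ω) μ := hint (hA.mul hB) (hbmul bA bB)
  have iAC : Integrable (fun ω => A ω * C ω) μ := hint (hA.mul hC) (hbmul bA bC)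
  have iBC : Integrable (fun ω => B ω * C ω) μ := hint (hB.mul hC) (hbmul bB bC)
  have iABC : Integrable (fun ω => A ω * B ω * C ω) μ :=
    hint ((hA.mul hB).mul hC) (hbmul (hbmul bA bB) bC)
  set a := ∫ ω, A ω ∂μ with ha
  set b := ∫ ω, B ω ∂μ with hb
  set c₀ := ∫ ω, C ω ∂μ with hc₀
  have e : (fun ω => (A ω - a) * (B ω - b) * (C ω - c₀)) = fun ω =>
      A ω * B ω * C ω - a * (B ω * C ω) - b * (A ω * C ω) - c₀ * (A ω * B ω) +
        a * b * C ω + a * c₀ * B ω + b * c₀ * A ω - a * b * c₀ := by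
    funext ω; ring
  rw [e]
  simp (disch := fun_prop) only [integral_sub, integral_add, integral_const_mul, integral_const,
    probReal_univ, one_smul]
  rw [← ha, ← hb, ← hc₀]
  ring

variable {G : Type} [Group G] [TopologicalSpace G] [IsTopologicalGroup G] [CompactSpace G]
  [MeasurableSpace G] [BorelSpace G]

/-- The smeared renormalised curvature field of scheme `S` at step `k` on one test function, as a function
of the torus configuration (the integrand of `latticeSchwinger`). [folklore] -/
def fld (r : LatticeRep G) (S : SpeciesScheme (YMSpecies G)) (k : ℕ) (w : 𝓢(E4, ℝ))
    (U : GaugeConfig 4 (S.side k) G) : ℝ :=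
  smearedLatticeField r.curvature.F (Literature.Probability.LatticeModels.box 4 (S.L k)) (S.a k)
    (S.c r.curvature k) (S.m r.curvature k) w (torusLift (S.side k) U)

/-- The constant by which the renormalisation `(c_k, m_k)` shifts the smeared field,
`c_k a_k⁴ Σₓ w(a_k x) m_k`. [folklore] -/
def shift (r : LatticeRep G) (S : SpeciesScheme (YMSpecies G)) (k : ℕ) (w : 𝓢(E4, ℝ)) : ℝ :=
  S.c r.curvature k * (S.a k) ^ 4 *
    ∑ x ∈ Literature.Probability.LatticeModels.box 4 (S.L k), w (S.a k • siteToE x) * S.m r.curvature k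

/-- **Affine renormalisation**: the scheme-`S` field is `c_k` times the BARE field minus a constant
(`smearedLatticeField_affine`). [folklore] -/
theorem fld_eq_bare (r : LatticeRep G) (S : SpeciesScheme (YMSpecies G)) (k : ℕ) (w : 𝓢(E4, ℝ))
    (U : GaugeConfig 4 (S.side k) G) :
    fld r S k w U = S.c r.curvature k * fld r (bare S) k w U - shift r S k w :=
  Summit.QuantumFields.YangMills.Theorems.ScalingWindowSplit.smearedLatticeField_affine r.curvature.F _ (S.a k)
    (S.c r.curvature k) (S.m r.curvature k) w _

/-- The field function is measurable. [folklore] -/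
theorem measurable_fld (r : LatticeRep G) (S : SpeciesScheme (YMSpecies G)) (k : ℕ) (w : 𝓢(E4, ℝ)) :
    Measurable (fld r S k w) :=
  measurable_smearedLatticeField_torusLift r.curvature _ _ _ _ w (S.side k)

/-- The field function is bounded. [folklore] -/
theorem exists_bound_fld (r : LatticeRep G) (S : SpeciesScheme (YMSpecies G)) (k : ℕ)
    (w : 𝓢(E4, ℝ)) : ∃ K, ∀ U, |fld r S k w U| ≤ K := by
  obtain ⟨B, hB⟩ := exists_bound_smearedLatticeField r.curvature.bounded
    (Literature.Probability.LatticeModels.box 4 (S.L k)) (S.a k) (S.c r.curvature k)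
    (S.m r.curvature k) w
  exact ⟨B, fun U => hB _⟩

/-- The field function is integrable for Wilson's (probability) measure. [folklore] -/
theorem integrable_fld (r : LatticeRep G) (S : SpeciesScheme (YMSpecies G)) (k : ℕ) (w : 𝓢(E4, ℝ)) :
    Integrable (fld r S k w) (wilsonMeasure r.ρ (S.β k) : Measure (GaugeConfig 4 (S.side k) G)) := by
  haveI : IsProbabilityMeasure (wilsonMeasure (d := 4) (L := S.side k) (G := G) r.ρ (S.β k)) :=
    isProbabilityMeasure_wilsonMeasure r.ρ r.continuous (S.β k)
  obtain ⟨K, hK⟩ := exists_bound_fld r S k w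
  exact Integrable.of_bound (measurable_fld r S k w).aestronglyMeasurable K
    (ae_of_all _ fun U => by rw [Real.norm_eq_abs]; exact hK U)

/-- **The cumulant polynomial of `latticeSchwinger` is the third central moment of the field functions.**
[folklore] -/
theorem kappa3_eq_central (r : LatticeRep G) (S : SpeciesScheme (YMSpecies G))
    (f g h : 𝓢(E4, ℝ)) (k : ℕ) :
    kappa3 r S f g h k =
      ∫ U, (fld r S k f U - ∫ U', fld r S k f U' ∂(wilsonMeasure r.ρ (S.β k))) *
          (fld r S k g U - ∫ U', fld r S k g U' ∂(wilsonMeasure r.ρ (S.β k))) *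
          (fld r S k h U - ∫ U', fld r S k h U' ∂(wilsonMeasure r.ρ (S.β k)))
        ∂(wilsonMeasure r.ρ (S.β k) : Measure (GaugeConfig 4 (S.side k) G)) := by
  haveI : IsProbabilityMeasure (wilsonMeasure (d := 4) (L := S.side k) (G := G) r.ρ (S.β k)) :=
    isProbabilityMeasure_wilsonMeasure r.ρ r.continuous (S.β k)
  rw [← cumulant3_eq_central (measurable_fld r S k f) (measurable_fld r S k g) (measurable_fld r S k h)
    (exists_bound_fld r S k f) (exists_bound_fld r S k g) (exists_bound_fld r S k h)]
  simp only [kappa3, latticeSchwinger, fld, Fin.prod_univ_one, Fin.prod_univ_two, Fin.prod_univ_three,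
    Matrix.cons_val_zero, Matrix.cons_val_one, Matrix.cons_val_two, Matrix.head_cons, Matrix.tail_cons,
    Matrix.cons_val_fin_one]

/-- **Affine invariance of the third cumulant**: for ANY scheme `S`, the joint third cumulant of the smeared
curvature fields is `c_k³` times that of the BARE scheme (the renormalised field is `c_k` times the bare
field minus a constant, `smearedLatticeField_affine`; cumulants of order `≥ 2` are shift-blind and
multilinear).  Order-3 twin of the landed `trunc_rescale`. [folklore] -/
theorem kappa3_rescale (r : LatticeRep G) (S : SpeciesScheme (YMSpecies G)) (f g h : 𝓢(E4, ℝ))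
    (k : ℕ) : kappa3 r S f g h k = (S.c r.curvature k) ^ 3 * kappa3 r (bare S) f g h k := by
  haveI : IsProbabilityMeasure (wilsonMeasure (d := 4) (L := S.side k) (G := G) r.ρ (S.β k)) :=
    isProbabilityMeasure_wilsonMeasure r.ρ r.continuous (S.β k)
  -- the bare cumulant as a central moment, read on the (definitionally equal) torus and measure of `S`
  have hb : kappa3 r (bare S) f g h k =
      ∫ U, (fld r (bare S) k f U -
              ∫ U' : GaugeConfig 4 (S.side k) G, fld r (bare S) k f U' ∂(wilsonMeasure r.ρ (S.β k))) *
          (fld r (bare S) k g U -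
              ∫ U' : GaugeConfig 4 (S.side k) G, fld r (bare S) k g U' ∂(wilsonMeasure r.ρ (S.β k))) *
          (fld r (bare S) k h U -
              ∫ U' : GaugeConfig 4 (S.side k) G, fld r (bare S) k h U' ∂(wilsonMeasure r.ρ (S.β k)))
        ∂(wilsonMeasure r.ρ (S.β k) : Measure (GaugeConfig 4 (S.side k) G)) :=
    kappa3_eq_central r (bare S) f g h k
  -- means transform affinely
  have mean : ∀ w : 𝓢(E4, ℝ),
      ∫ U', fld r S k w U' ∂(wilsonMeasure r.ρ (S.β k) : Measure (GaugeConfig 4 (S.side k) G)) =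
        S.c r.curvature k *
            ∫ U', fld r (bare S) k w U' ∂(wilsonMeasure r.ρ (S.β k) : Measure (GaugeConfig 4 (S.side k) G)) -
          shift r S k w := by
    intro w
    have e : (fun U' : GaugeConfig 4 (S.side k) G => fld r S k w U') =
        fun U' : GaugeConfig 4 (S.side k) G => S.c r.curvature k * fld r (bare S) k w U' - shift r S k w := by
      funext U'; exact fld_eq_bare r S k w U'
    have hfi : Integrable (fun U' : GaugeConfig 4 (S.side k) G => S.c r.curvature k * fld r (bare S) k w U')
        (wilsonMeasure r.ρ (S.β k) : Measure (GaugeConfig 4 (S.side k) G)) :=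
      (integrable_fld r (bare S) k w).const_mul _
    rw [e, integral_sub hfi (integrable_const _), integral_const_mul, integral_const, probReal_univ, one_smul]
  rw [kappa3_eq_central, hb, ← integral_const_mul]
  congr 1
  funext U
  rw [fld_eq_bare r S k f U, fld_eq_bare r S k g U, fld_eq_bare r S k h U, mean f, mean g, mean h]
  ring

/-- `bare (canon r sch u) = bare sch` (self-normalisation only touches `(c, m)`). [folklore] -/
theorem bare_canon (r : LatticeRep G) (sch : SpeciesScheme (YMSpecies G)) (u : 𝓢(E4, ℝ)) :
    bare (canon r sch u) = bare sch := rfl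

/-- **The order-3 seam identity of the crux** — verbatim the birth line's `ThirdCumulantSeam` /
registered `stub_thirdCumulantSeam` (in definitionally equal vocabulary), PROVED:
`κ₃^canon_k(f,g,h) = ((√T⁰_k(u,θu))⁻¹)³ · κ₃⁰_k(f,g,h)` for every datum, every triple and every `k`
(no positivity needed: if `T⁰_k(u) ≤ 0` the junk value `(√·)⁻¹ = 0` scales both sides consistently). [folklore] -/
theorem thirdCumulantSeam :
    ∀ (G : Type) [Group G] [TopologicalSpace G] [IsTopologicalGroup G] [CompactSpace G]
      [MeasurableSpace G] [BorelSpace G] (r : LatticeRep G) (sch : SpeciesScheme (YMSpecies G))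
      (u f g h : 𝓢(E4, ℝ)) (k : ℕ),
      kappa3 r (canon r sch u) f g h k = (Real.sqrt (Tbare r sch u k))⁻¹ ^ 3 * kappa3 r (bare sch) f g h k := by
  intro G _ _ _ _ _ _ r sch u f g h k
  rw [kappa3_rescale, bare_canon]
  rfl

end Seam

/-! ## The composition: the three stubs conclude the crux BY NAME (sorry-free) -/

/-- Reflection sends a past-supported test function to a future-supported one, so `supp w ∩ supp θw = ∅`.
[folklore] -/
theorem disjoint_tsupport_thetaTest {w : 𝓢(E4, ℝ)} (hw : tsupport w ⊆ {y : E4 | y 0 < 0}) :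
    Disjoint (tsupport w) (tsupport (thetaTest 4 w)) := by
  have hθ := Summit.QuantumFields.YangMills.Theorems.ScalingWindowSplit.tsupport_thetaTest_pos' hw
  exact Set.disjoint_left.2 fun x hx hx' => by
    have h1 : x 0 < 0 := hw hx
    have h2 : 0 < x 0 := hθ hx'
    exact lt_asymm h1 h2

/-- **`SelfNormalisedSkewnessGapped_of` — the line's composition.**  Fix an admissible datum.  Stub 1 gives
the ceiling `T⁰_k(u) ≤ C a_k⁸`, stub 2 a radius `ρ₀` and floors `c a_k⁸ ≤ T⁰_k(w)` for small past bumps,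
stub 3 a triple `(w, h, θw)` inside `B(0,ρ₀)` with `s a_k⁻⁴ T⁰_k(w)² ≤ |κ₃⁰_k|`; the floor hypothesis
makes `T⁰_k(u) > 0` (so `C > 0`); by the PROVED seam `κ₃^canon = T⁰(u)^{-3/2} κ₃⁰`, eventually
`|κ₃^canon_k(w,h,θw)| ≥ (C a⁸)^{-3/2} · s a⁻⁴ (c a⁸)² = s c²/√C³ =: δ > 0`. [folklore] -/
theorem SelfNormalisedSkewnessGapped_of (hCeil : Sig.stub_pairCeiling) (hFloor : Sig.stub_shortPairFloor)
    (hSkew : Sig.stub_quarticSkewTransfer) :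
    Summit.QuantumFields.YangMills.Theses.ScalingWindowSplit.SelfNormalisedSkewnessGapped := by
  unfold Summit.QuantumFields.YangMills.Theses.ScalingWindowSplit.SelfNormalisedSkewnessGapped
  dsimp only
  intro G _ _ _ _ _ _ r sch u p M Δ hw hΔ hgap hpv hu hfw
  have hH : CruxHyps r sch u p M Δ := ⟨hw, hΔ, hgap, hpv, hu, hfw⟩
  obtain ⟨C, hC⟩ := hCeil G r sch u p M Δ hH
  obtain ⟨ρ₀, hρ₀, hF⟩ := hFloor G r sch u p M Δ hH
  obtain ⟨w, h, hw0, hwsupp, hwball, hwh, hhθ, s, hs, hS⟩ := hSkew G r sch u p M Δ hH ρ₀ hρ₀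
  obtain ⟨c, hc, hcw⟩ := hF w hw0 hwsupp hwball
  replace hfw : ∀ᶠ k in atTop, (sch.a k) ^ p ≤ Tbare r sch u k ∧
      Tbare r sch u k ≤ M * Tbare r sch (timeShiftTest 4 (-1) u) k := hfw
  have hwθ : Disjoint (tsupport w) (tsupport (thetaTest 4 w)) := disjoint_tsupport_thetaTest hwsupp
  have hfw' : ∀ᶠ k in atTop, (sch.a k) ^ p ≤ Tbare r sch u k := hfw.mono fun k hk => hk.1
  -- the ceiling constant is positive (floor ∧ ceiling at one common step)
  have hCpos : 0 < C := by
    obtain ⟨k, hk₁, hk₂⟩ := (hfw'.and hC).exists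
    have ha : 0 < sch.a k := sch.a_pos k
    have h8 : 0 < (sch.a k) ^ 8 := pow_pos ha 8
    have : 0 < C * (sch.a k) ^ 8 := lt_of_lt_of_le (pow_pos ha p) (hk₁.trans hk₂)
    exact (mul_pos_iff_of_pos_right h8).mp this
  refine ⟨w, h, thetaTest 4 w, s * c ^ 2 / (Real.sqrt C) ^ 3, hwh, hwθ, hhθ, ?_, ?_⟩
  · have : 0 < Real.sqrt C := Real.sqrt_pos.2 hCpos
    positivity
  · have key : ∀ᶠ k in atTop, s * c ^ 2 / (Real.sqrt C) ^ 3 ≤ |kappa3 r (canon r sch u) w h (thetaTest 4 w) k| := by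
      filter_upwards [hfw', hC, hcw, hS] with k hfk hCk hck hSk
      have ha : 0 < sch.a k := sch.a_pos k
      set A := sch.a k with hA
      have hTu : 0 < Tbare r sch u k := lt_of_lt_of_le (pow_pos ha p) hfk
      have hsqrt_pos : 0 < Real.sqrt (Tbare r sch u k) := Real.sqrt_pos.2 hTu
      -- upper bound on √T(u): √T(u) ≤ √C · A⁴
      have hsqrt_le : Real.sqrt (Tbare r sch u k) ≤ Real.sqrt C * A ^ 4 := by
        have h1 : Real.sqrt (Tbare r sch u k) ≤ Real.sqrt (C * A ^ 8) := Real.sqrt_le_sqrt hCk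
        have h2 : Real.sqrt (C * A ^ 8) = Real.sqrt C * A ^ 4 := by
          rw [Real.sqrt_mul hCpos.le, show (A ^ 8 : ℝ) = (A ^ 4) ^ 2 by ring,
            Real.sqrt_sq (by positivity)]
        exact h1.trans_eq h2
      -- lower bound on the inverse cube
      have hinv : (Real.sqrt C * A ^ 4)⁻¹ ≤ (Real.sqrt (Tbare r sch u k))⁻¹ :=
        inv_anti₀ hsqrt_pos hsqrt_le
      have hinv3 : ((Real.sqrt C * A ^ 4)⁻¹) ^ 3 ≤ ((Real.sqrt (Tbare r sch u k))⁻¹) ^ 3 :=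
        pow_le_pow_left₀ (by positivity) hinv 3
      -- lower bound on the bare cumulant
      have hTw : c * A ^ 8 ≤ Tbare r sch w k := hck
      have hTw0 : 0 ≤ Tbare r sch w k := (by positivity : (0:ℝ) ≤ c * A ^ 8).trans hTw
      have hsq : (c * A ^ 8) ^ 2 ≤ (Tbare r sch w k) ^ 2 :=
        pow_le_pow_left₀ (by positivity) hTw 2
      have hkb : s * (A ^ 4)⁻¹ * (c * A ^ 8) ^ 2 ≤ |kappa3 r (bare sch) w h (thetaTest 4 w) k| := by
        refine le_trans ?_ hSk
        have : 0 ≤ s * (A ^ 4)⁻¹ := by positivity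
        exact mul_le_mul_of_nonneg_left hsq this
      -- assemble
      rw [thirdCumulantSeam G r sch u w h (thetaTest 4 w) k, abs_mul, abs_of_nonneg (by positivity : (0:ℝ) ≤ ((Real.sqrt (Tbare r sch u k))⁻¹) ^ 3)]
      have hprod : ((Real.sqrt C * A ^ 4)⁻¹) ^ 3 * (s * (A ^ 4)⁻¹ * (c * A ^ 8) ^ 2) ≤
          ((Real.sqrt (Tbare r sch u k))⁻¹) ^ 3 * |kappa3 r (bare sch) w h (thetaTest 4 w) k| :=
        mul_le_mul hinv3 hkb (by positivity) (by positivity)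
      refine le_trans (le_of_eq ?_) hprod
      have hsC : Real.sqrt C ≠ 0 := (Real.sqrt_pos.2 hCpos).ne'
      have hA0 : A ≠ 0 := ha.ne'
      field_simp
    exact key

/-- **The line, plugged**: the three registered stubs give the crux BY NAME (sorries exactly in the stubs). [folklore] -/
theorem SelfNormalisedSkewnessGapped_skeleton :
    Summit.QuantumFields.YangMills.Theses.ScalingWindowSplit.SelfNormalisedSkewnessGapped :=
  SelfNormalisedSkewnessGapped_of stub_pairCeiling stub_shortPairFloor stub_quarticSkewTransfer

end Summit.QuantumFields.YangMills.Cruxes.SelfNormalisedSkewnessGapped.QuarticUvTransfer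

end
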